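import Literature.Geometry.GeometricMeasureTheory.PushforwardRectifiable
import Literature.Geometry.GeometricMeasureTheory.RectifiableImagePieceBasis
import Literature.Geometry.GeometricMeasureTheory.CurrentsProductBoundary
import Mathlib.MeasureTheory.Integral.Bochner.SumMeasure

/-!
# Push-forwards of `[0,1] × T` along smooth homotopies are rectifiable

For a rectifiable current `T ∈ 𝓡_m(V)` (compact support), a smooth `H : ℝ × V → V'` and a cutoff
`χ` equal to `1` on `[0,1] × spt T`, **`H_#([0,1] × T) ∈ 𝓡_{m+1}(V')`**
(`Current.IsRectifiable.pushforward_prodInterval_top`), where `[0,1] × T = T.prodInterval 0 1`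
is the product current of `CurrentsProduct.lean` (Federer 4.1.8). This is the rectifiability of
the current `S` in the homotopy formula (Federer 4.1.9) for rectifiable `T`, needed e.g. for the
flat-norm convergence of blow-ups (King's tangent cone theorem).

The proof repeats that of `Current.IsRectifiable.pushforward_top` (Federer 4.1.30,
`PushforwardRectifiable.lean`) with the parameter pieces `(0,1] × Eⱼ ⊆ ℝ × ℝᵐ` (an inner product
space as `WithLp 2 (ℝ × ℝᵐ)`, orthonormal basis `prodBasis = (e₀, (0,eᵢ))`) and the maps
`Ĝⱼ(t,u) = H(t, gⱼ u)`: by Fubini, `H_#([0,1] × T)(ψ) = ∫_{(0,1] × W} θ ψ(H)(DH(e₀ ∧ ξ))`, and on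
each piece the frame `e₀ ∧ ξ(gⱼ u)` is `± J(gⱼ)⁻¹ e₀ ∧ Dgⱼ e` (`Multivector.consTime` applied to
`pieceDensity_smul_frameVector`).

Definitions with bodies (`prodBasis`, `Multivector.consTime`, `prodPieceDensity`) + theorems; no
named facts.

## References

* H. Federer, *Geometric Measure Theory*, Springer 1969, 4.1.8, 4.1.9, 4.1.30 [Federer1969].
-/

noncomputable section

open scoped InnerProductSpace ENNReal NNReal Topology Distributions ContDiff
open MeasureTheory MeasureTheory.Measure Set Function Filter Module InnerProductSpace TopologicalSpace
  WithLp
open Literature.Analysis.Calculus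

namespace Literature.Geometry.GeometricMeasureTheory

-- Nested operator-norm instances on (duals of) `V [⋀^Fin n]→L[ℝ] ℝ`.
set_option maxSynthPendingDepth 2

/-! ### The parameter space `ℝ × ℝᵐ` as an inner product space -/

section ProdBasis

variable (m : ℕ)

local notation "𝔼" => EuclideanSpace ℝ (Fin m)
local notation "𝕖" => EuclideanSpace.basisFun (Fin m) ℝ
local notation "ℙ" => WithLp 2 (ℝ × EuclideanSpace ℝ (Fin m))

/-- The frame `(e₀, (0, e₁), …, (0, eₘ))` of `ℝ × ℝᵐ`. [folklore] -/
def prodFrame : Fin (m + 1) → ℙ :=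
  Fin.cons (toLp 2 ((1 : ℝ), (0 : 𝔼))) fun i => toLp 2 ((0 : ℝ), (𝕖 i : 𝔼))

/-- `prodFrame` is orthonormal in `WithLp 2 (ℝ × ℝᵐ)`. [folklore] -/
theorem orthonormal_prodFrame : Orthonormal ℝ (prodFrame m) := by
  rw [orthonormal_iff_ite]
  intro i j
  refine Fin.cases ?_ (fun i => ?_) i <;> refine Fin.cases ?_ (fun j => ?_) j
  · simp [prodFrame]
  · simp [prodFrame, (Fin.succ_ne_zero j).symm]
  · simp [prodFrame, Fin.succ_ne_zero i]
  · simp only [prodFrame, Fin.cons_succ, prod_inner_apply, inner_zero_left, zero_add,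
      Fin.succ_inj]
    rw [orthonormal_iff_ite.1 (EuclideanSpace.basisFun (Fin m) ℝ).orthonormal i j]

/-- **The orthonormal basis `(e₀, (0, e₁), …, (0, eₘ))` of `ℝ × ℝᵐ`.** [folklore] -/
def prodBasis : OrthonormalBasis (Fin (m + 1)) ℝ ℙ :=
  OrthonormalBasis.mk (orthonormal_prodFrame m) (by
    rw [(orthonormal_prodFrame m).linearIndependent.span_eq_top_of_card_eq_finrank']
    rw [Fintype.card_fin, (WithLp.linearEquiv 2 ℝ (ℝ × 𝔼)).finrank_eq, Module.finrank_prod,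
      Module.finrank_self, finrank_euclideanSpace_fin, add_comm])

/-- Values of `prodBasis`. [folklore] -/
@[simp] theorem prodBasis_zero : prodBasis m 0 = toLp 2 ((1 : ℝ), (0 : 𝔼)) := by
  rw [prodBasis, OrthonormalBasis.coe_mk]; rfl

/-- Values of `prodBasis`. [folklore] -/
@[simp] theorem prodBasis_succ (i : Fin m) : prodBasis m i.succ = toLp 2 ((0 : ℝ), (𝕖 i : 𝔼)) := by
  rw [prodBasis, OrthonormalBasis.coe_mk]; rfl

end ProdBasis

/-! ### `e₀ ∧ ·` : `m`-vectors of `V` to `(m+1)`-vectors of `ℝ × V` -/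

section ConsTime

variable {V : Type*} [NormedAddCommGroup V] [NormedSpace ℝ V] {m : ℕ}

/-- **`w ↦ e₀ ∧ (0 ⊕ w)`**: the transpose of the slice map `covSlice` on covectors.
[cite: Federer1969, 4.1.8] -/
def Multivector.consTime : Multivector V m →L[ℝ] Multivector (ℝ × V) (m + 1) :=
  ContinuousLinearMap.precomp ℝ (covSliceCLM (E := V) (F := ℝ) (m := m))

/-- Unfolding `consTime`. [folklore] -/
@[simp] theorem Multivector.consTime_apply (w : Multivector V m) (ζ : Covector (ℝ × V) (m + 1)) :
    Multivector.consTime w ζ = w (covSlice ζ) := rfl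

/-- **`e₀ ∧ (0, v₁) ∧ ⋯ ∧ (0, vₘ) = consTime (v₁ ∧ ⋯ ∧ vₘ)`.** [cite: Federer1969, 4.1.8] -/
theorem Multivector.consTime_frameVector (v : Fin m → V) :
    Multivector.consTime (frameVector v) =
      frameVector (Fin.cons ((1 : ℝ), (0 : V)) fun i => ((0 : ℝ), v i)) := by
  ext ζ
  rw [Multivector.consTime_apply, frameVector_apply, frameVector_apply, covSlice_apply]

/-- Pushing a cons-frame: `A e₀ ∧ A(0,v₁) ∧ ⋯ = push A (consTime (v₁ ∧ ⋯ ∧ vₘ))`. [folklore] -/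
theorem Multivector.push_consTime_frameVector {V' : Type*} [NormedAddCommGroup V'] [NormedSpace ℝ V']
    (A : (ℝ × V) →L[ℝ] V') (v : Fin m → V) :
    Multivector.push A (Multivector.consTime (frameVector v)) =
      frameVector (Fin.cons (A ((1 : ℝ), (0 : V))) fun i => A ((0 : ℝ), v i)) := by
  rw [Multivector.consTime_frameVector, Multivector.push_frameVector]
  congr 1
  funext i
  refine Fin.cases ?_ (fun i => ?_) i <;> simp

/-- Norm bound `‖consTime w‖ ≤ ‖w‖`. [folklore] -/
theorem Multivector.norm_consTime_le (w : Multivector V m) : ‖Multivector.consTime w‖ ≤ ‖w‖ := by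
  refine ContinuousLinearMap.opNorm_le_bound _ (norm_nonneg _) fun ζ => ?_
  rw [Multivector.consTime_apply]
  exact (w.le_opNorm _).trans (by gcongr; exact norm_covSlice_le ζ)

end ConsTime

/-! ### Product pieces `(0,1] × Eⱼ` and the maps `Ĝ(t,u) = H(t, g u)` -/

section ProdPiece

variable {V : Type*} [NormedAddCommGroup V] [InnerProductSpace ℝ V] [FiniteDimensional ℝ V]
  [MeasurableSpace V] [BorelSpace V]
  {V' : Type*} [NormedAddCommGroup V'] [InnerProductSpace ℝ V'] [FiniteDimensional ℝ V']
  [MeasurableSpace V'] [BorelSpace V'] {m : ℕ}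

local notation "𝔼" => EuclideanSpace ℝ (Fin m)
local notation "𝕖" => EuclideanSpace.basisFun (Fin m) ℝ
local notation "ℙ" => WithLp 2 (ℝ × EuclideanSpace ℝ (Fin m))

variable {g : EuclideanSpace ℝ (Fin m) → V} {E : Set (EuclideanSpace ℝ (Fin m))}
  {θ : V → ℤ} {ξ : V → Fin m → V} {H : ℝ × V → V'}

/-- The map `Ĝ(t,u) = H(t, g u)` on the parameter space `ℝ × ℝᵐ`. [cite: Federer1969, 4.1.9] -/
def prodMap (H : ℝ × V → V') (g : EuclideanSpace ℝ (Fin m) → V) (v : ℙ) : V' :=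
  H ((ofLp v).1, g (ofLp v).2)

/-- Its differential `DĜ(t,u) = DH(t, g u) ∘ (id × Dg(u))`. [folklore] -/
def prodDeriv (H : ℝ × V → V') (g : EuclideanSpace ℝ (Fin m) → V) (v : ℙ) : ℙ →L[ℝ] V' :=
  (fderiv ℝ H ((ofLp v).1, g (ofLp v).2)).comp
    ((((ContinuousLinearMap.id ℝ ℝ).prodMap (fderiv ℝ g (ofLp v).2))).comp
      (prodContinuousLinearEquiv 2 ℝ ℝ (EuclideanSpace ℝ (Fin m)) : ℙ →L[ℝ] ℝ × 𝔼))

/-- The parameter-side density of a product piece: `pieceDensity` in the `ℝᵐ`-variable.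
[cite: Federer1969, 4.1.30] -/
def prodPieceDensity (g : EuclideanSpace ℝ (Fin m) → V) (θ : V → ℤ) (ξ : V → Fin m → V) (v : ℙ) : ℤ :=
  pieceDensity g θ ξ (ofLp v).2

omit [FiniteDimensional ℝ V] [MeasurableSpace V] [BorelSpace V]
  [FiniteDimensional ℝ V'] [MeasurableSpace V'] [BorelSpace V'] in
/-- `Ĝ` is differentiable where `g` is, with differential `prodDeriv`. [folklore] -/
theorem hasFDerivAt_prodMap (hH : ContDiff ℝ 1 H) {v : ℙ}
    (hg : DifferentiableAt ℝ g (ofLp v).2) : HasFDerivAt (prodMap H g) (prodDeriv H g v) v := by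
  have h1 : HasFDerivAt (fun q : ℝ × 𝔼 => (q.1, g q.2))
      ((ContinuousLinearMap.id ℝ ℝ).prodMap (fderiv ℝ g (ofLp v).2)) (ofLp v) :=
    (hasFDerivAt_id (ofLp v).1).prodMap (ofLp v) hg.hasFDerivAt
  have h2 : HasFDerivAt (ofLp : ℙ → ℝ × 𝔼)
      (prodContinuousLinearEquiv 2 ℝ ℝ (EuclideanSpace ℝ (Fin m)) : ℙ →L[ℝ] ℝ × 𝔼) v :=
    (prodContinuousLinearEquiv 2 ℝ ℝ (EuclideanSpace ℝ (Fin m)) : ℙ →L[ℝ] ℝ × 𝔼).hasFDerivAt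
  have h3 := ((hH.differentiable one_ne_zero) _).hasFDerivAt.comp v (h1.comp v h2)
  exact h3

omit [FiniteDimensional ℝ V] [MeasurableSpace V] [BorelSpace V]
  [FiniteDimensional ℝ V'] [MeasurableSpace V'] [BorelSpace V'] in
/-- **The frame `DĜ(prodBasis)` is `DH` applied to `(e₀, (0, Dg e₁), …)`**:
`DĜ e₀ ∧ ⋯ = push DH (consTime (Dg e₁ ∧ ⋯ ∧ Dg eₘ))`. [cite: Federer1969, 4.1.9] -/
theorem frameVector_prodDeriv_prodBasis (v : ℙ) :
    frameVector (fun k => prodDeriv H g v (prodBasis m k)) =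
      Multivector.push (fderiv ℝ H ((ofLp v).1, g (ofLp v).2))
        (Multivector.consTime (frameVector fun i => fderiv ℝ g (ofLp v).2 (𝕖 i))) := by
  rw [Multivector.push_consTime_frameVector]
  congr 1
  funext k
  refine Fin.cases ?_ (fun i => ?_) k
  · simp [prodDeriv, prodContinuousLinearEquiv]
  · simp [prodDeriv, prodContinuousLinearEquiv]

omit [FiniteDimensional ℝ V] [MeasurableSpace V] [BorelSpace V]
  [FiniteDimensional ℝ V'] [MeasurableSpace V'] [BorelSpace V'] in
/-- **Pointwise identity on a product piece**: where `ξ(g u)` is an orthonormal frame of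
`im Dg(u)`, `prodPieceDensity • (DĜ e₀ ∧ ⋯) = J(Dg u) • push DH (consTime (θ • ξ)(g u))`.
[cite: Federer1969, 4.1.30] -/
theorem prodPieceDensity_smul_frameVector {v : ℙ}
    (hinj : Injective (fderiv ℝ g (ofLp v).2)) (hortho : Orthonormal ℝ (ξ (g (ofLp v).2)))
    (hspan : (Submodule.span ℝ (range (ξ (g (ofLp v).2))) : Set V) = range (fderiv ℝ g (ofLp v).2)) :
    (prodPieceDensity g θ ξ v : ℝ) • frameVector (fun k => prodDeriv H g v (prodBasis m k)) =
      (((fderiv ℝ g (ofLp v).2 : 𝔼 →L[ℝ] V) : 𝔼 →ₗ[ℝ] V).normDet) •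
        Multivector.push (fderiv ℝ H ((ofLp v).1, g (ofLp v).2))
          (Multivector.consTime ((θ (g (ofLp v).2) : ℝ) • frameVector (ξ (g (ofLp v).2)))) := by
  have h := congrArg (fun w => Multivector.push (fderiv ℝ H ((ofLp v).1, g (ofLp v).2))
    (Multivector.consTime (m := m) w)) (pieceDensity_smul_frameVector (θ := θ) hinj hortho hspan)
  simp only [map_smul] at h
  rw [frameVector_prodDeriv_prodBasis]
  exact h

/-- Transport of an a.e. statement from Lebesgue measure on `E ⊆ ℝᵐ` to the product piece
`ofLp ⁻¹' (S × E) ⊆ ℝ × ℝᵐ`. [folklore] -/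
theorem ae_restrict_prodPiece {p : EuclideanSpace ℝ (Fin m) → Prop} {S : Set ℝ} (hS : MeasurableSet S)
    (hE : MeasurableSet E) (h : ∀ᵐ u ∂(volume.restrict E), p u) :
    ∀ᵐ v ∂((volume : Measure ℙ).restrict (ofLp ⁻¹' (S ×ˢ E))), p (ofLp v).2 := by
  have hmp := WithLp.volume_preserving_ofLp ℝ (EuclideanSpace ℝ (Fin m))
  -- on `ℝ × ℝᵐ`
  have h1 : ∀ᵐ q ∂(volume : Measure (ℝ × 𝔼)), q.2 ∈ E → p q.2 := by
    rw [volume_eq_prod]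
    have h' : ∀ᵐ u ∂(volume : Measure 𝔼), u ∈ E → p u := (ae_restrict_iff' hE).1 h
    exact (quasiMeasurePreserving_snd (μ := (volume : Measure ℝ))
      (ν := (volume : Measure 𝔼))).ae h'
  have h2 : ∀ᵐ v ∂(volume : Measure ℙ), (ofLp v).2 ∈ E → p (ofLp v).2 :=
    hmp.quasiMeasurePreserving.ae h1
  have hmeas : MeasurableSet ((ofLp : ℙ → ℝ × 𝔼) ⁻¹' (S ×ˢ E)) :=
    (MeasurableEquiv.toLp 2 (ℝ × 𝔼)).symm.measurable (hS.prod hE)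
  rw [ae_restrict_iff' hmeas]
  filter_upwards [h2] with v hv hvS
  exact hv hvS.2

omit [FiniteDimensional ℝ V'] [MeasurableSpace V'] [BorelSpace V'] in
/-- **The a.e. identity on a product piece** `ofLp ⁻¹' (S × E)`. [cite: Federer1969, 4.1.30] -/
theorem ae_prodPieceDensity_smul_frameVector {S : Set ℝ} (hS : MeasurableSet S)
    (hE : MeasurableSet E) (hgd : ∀ u ∈ E, DifferentiableAt ℝ g u ∧ Injective (fderiv ℝ g u))
    (hgi : InjOn g E)
    (hframe : ∀ᵐ y ∂((μHE[m] : Measure V).restrict (g '' E)), ∀ u ∈ E, g u = y →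
      Orthonormal ℝ (ξ y) ∧ ((Submodule.span ℝ (range (ξ y)) : Set V) = range (fderiv ℝ g u))) :
    ∀ᵐ v ∂((volume : Measure ℙ).restrict (ofLp ⁻¹' (S ×ˢ E))),
      (prodPieceDensity g θ ξ v : ℝ) • frameVector (fun k => prodDeriv H g v (prodBasis m k)) =
        (((fderiv ℝ g (ofLp v).2 : 𝔼 →L[ℝ] V) : 𝔼 →ₗ[ℝ] V).normDet) •
          Multivector.push (fderiv ℝ H ((ofLp v).1, g (ofLp v).2))
            (Multivector.consTime ((θ (g (ofLp v).2) : ℝ) • frameVector (ξ (g (ofLp v).2)))) := by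
  have hgd' : ∀ u ∈ E, HasFDerivWithinAt g (fderiv ℝ g u) E u := fun u hu =>
    (hgd u hu).1.hasFDerivAt.hasFDerivWithinAt
  have hframe' : ∀ᵐ y ∂((μHE[finrank ℝ 𝔼] : Measure V).restrict (g '' E)), ∀ u ∈ E, g u = y →
      Orthonormal ℝ (ξ y) ∧ ((Submodule.span ℝ (range (ξ y)) : Set V) = range (fderiv ℝ g u)) := by
    rwa [finrank_euclideanSpace_fin]
  have h := ae_restrict_comp_of_ae_restrict_image hE hgd' (fun u hu => (hgd u hu).2) hgi hframe'
  have hlift := ae_restrict_prodPiece (S := S) hS hE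
    (p := fun u => u ∈ E → Orthonormal ℝ (ξ (g u)) ∧
      ((Submodule.span ℝ (range (ξ (g u))) : Set V) = range (fderiv ℝ g u)))
    (by filter_upwards [h] with u hu huE using hu u huE rfl)
  have hmeas : MeasurableSet ((ofLp : ℙ → ℝ × 𝔼) ⁻¹' (S ×ˢ E)) :=
    (MeasurableEquiv.toLp 2 (ℝ × 𝔼)).symm.measurable (hS.prod hE)
  filter_upwards [hlift, ae_restrict_mem hmeas] with v hv hvmem
  obtain ⟨ho, hs⟩ := hv hvmem.2
  exact prodPieceDensity_smul_frameVector (hgd _ hvmem.2).2 ho hs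

/-! #### The `ℝ × ℝᵐ`-side form of the a.e. identity -/

omit [FiniteDimensional ℝ V'] [MeasurableSpace V'] [BorelSpace V'] in
/-- The a.e. identity on `S × E ⊆ ℝ × ℝᵐ` (Lebesgue measure). [cite: Federer1969, 4.1.30] -/
theorem ae_pieceDensity_smul_frameVector_prod {S : Set ℝ} (hS : MeasurableSet S)
    (hE : MeasurableSet E) (hgd : ∀ u ∈ E, DifferentiableAt ℝ g u ∧ Injective (fderiv ℝ g u))
    (hgi : InjOn g E)
    (hframe : ∀ᵐ y ∂((μHE[m] : Measure V).restrict (g '' E)), ∀ u ∈ E, g u = y →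
      Orthonormal ℝ (ξ y) ∧ ((Submodule.span ℝ (range (ξ y)) : Set V) = range (fderiv ℝ g u))) :
    ∀ᵐ q ∂((volume : Measure (ℝ × 𝔼)).restrict (S ×ˢ E)),
      (pieceDensity g θ ξ q.2 : ℝ) •
          frameVector (fun k => prodDeriv H g (toLp 2 q) (prodBasis m k)) =
        (((fderiv ℝ g q.2 : 𝔼 →L[ℝ] V) : 𝔼 →ₗ[ℝ] V).normDet) •
          Multivector.push (fderiv ℝ H (q.1, g q.2))
            (Multivector.consTime ((θ (g q.2) : ℝ) • frameVector (ξ (g q.2)))) := by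
  have hgd' : ∀ u ∈ E, HasFDerivWithinAt g (fderiv ℝ g u) E u := fun u hu =>
    (hgd u hu).1.hasFDerivAt.hasFDerivWithinAt
  have hframe' : ∀ᵐ y ∂((μHE[finrank ℝ 𝔼] : Measure V).restrict (g '' E)), ∀ u ∈ E, g u = y →
      Orthonormal ℝ (ξ y) ∧ ((Submodule.span ℝ (range (ξ y)) : Set V) = range (fderiv ℝ g u)) := by
    rwa [finrank_euclideanSpace_fin]
  have h := ae_restrict_comp_of_ae_restrict_image hE hgd' (fun u hu => (hgd u hu).2) hgi hframe'
  have h1 : ∀ᵐ q ∂(volume : Measure (ℝ × 𝔼)), q.2 ∈ E → Orthonormal ℝ (ξ (g q.2)) ∧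
      ((Submodule.span ℝ (range (ξ (g q.2))) : Set V) = range (fderiv ℝ g q.2)) := by
    rw [volume_eq_prod]
    have h' : ∀ᵐ u ∂(volume : Measure 𝔼), u ∈ E → Orthonormal ℝ (ξ (g u)) ∧
        ((Submodule.span ℝ (range (ξ (g u))) : Set V) = range (fderiv ℝ g u)) := by
      filter_upwards [(ae_restrict_iff' hE).1 h] with u hu huE using hu huE u huE rfl
    exact (quasiMeasurePreserving_snd (μ := (volume : Measure ℝ)) (ν := (volume : Measure 𝔼))).ae h'
  rw [ae_restrict_iff' (hS.prod hE)]
  filter_upwards [h1] with q hq hqmem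
  obtain ⟨ho, hs⟩ := hq hqmem.2
  have := prodPieceDensity_smul_frameVector (H := H) (θ := θ) (v := toLp 2 q) (hgd _ hqmem.2).2 ho hs
  simpa [prodPieceDensity] using this

/-! #### Integrability, the integral identity and the mass bound on a product piece -/

/-- The normalised parameter density `K(u) = J(Dg u) • (θ • ξ)(g u)` is integrable on `E` when
`θ • ξ` is integrable on `g(E)`. [cite: Federer1969, 3.2.5] -/
theorem integrableOn_normDet_smul_comp (hE : MeasurableSet E)
    (hgd : ∀ u ∈ E, DifferentiableAt ℝ g u ∧ Injective (fderiv ℝ g u)) (hgi : InjOn g E)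
    (hG : IntegrableOn (fun y => (θ y : ℝ) • frameVector (ξ y)) (g '' E) (μHE[m] : Measure V)) :
    IntegrableOn (fun u => (((fderiv ℝ g u : 𝔼 →L[ℝ] V) : 𝔼 →ₗ[ℝ] V).normDet) •
      ((θ (g u) : ℝ) • frameVector (ξ (g u)))) E := by
  have hgd' : ∀ u ∈ E, HasFDerivWithinAt g (fderiv ℝ g u) E u := fun u hu =>
    (hgd u hu).1.hasFDerivAt.hasFDerivWithinAt
  have hG' : IntegrableOn (fun y => (θ y : ℝ) • frameVector (ξ y)) (g '' E)
      (μHE[finrank ℝ 𝔼] : Measure V) := by rwa [finrank_euclideanSpace_fin]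
  exact (integrableOn_image_iff_integrableOn_normDet_smul hE hgd' (fun u hu => (hgd u hu).2) hgi
    (fun y => (θ y : ℝ) • frameVector (ξ y))).1 hG'

omit [FiniteDimensional ℝ V] [MeasurableSpace V] [BorelSpace V] [FiniteDimensional ℝ V']
  [MeasurableSpace V'] [BorelSpace V'] in
/-- The pushed field `q ↦ push DH(q.1, g q.2) (consTime (K q.2))` is integrable on `(0,1] × E`.
[folklore] -/
theorem integrableOn_push_consTime (hH : ContDiff ℝ 1 H) (hg : Continuous g) (hE : MeasurableSet E)
    {C : ℝ} (hC0 : 0 ≤ C) (hC : ∀ t ∈ Ioc (0 : ℝ) 1, ∀ u ∈ E, ‖fderiv ℝ H (t, g u)‖ ≤ C)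
    {K : EuclideanSpace ℝ (Fin m) → Multivector V m} (hK : IntegrableOn K E) :
    IntegrableOn (fun q : ℝ × 𝔼 => Multivector.push (m := m + 1) (fderiv ℝ H (q.1, g q.2))
      (Multivector.consTime (K q.2))) (Ioc (0 : ℝ) 1 ×ˢ E) := by
  have hmeasσ : AEStronglyMeasurable (fun q : ℝ × 𝔼 => Multivector.push (m := m + 1)
      (fderiv ℝ H (q.1, g q.2)) (Multivector.consTime (K q.2)))
      ((volume.restrict (Ioc (0 : ℝ) 1)).prod (volume.restrict E)) := by
    refine Continuous.comp_aestronglyMeasurable₂ (g := fun (A : (ℝ × V) →L[ℝ] V')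
      (w : Multivector (ℝ × V) (m + 1)) => Multivector.push A w) Multivector.continuous_push_uncurry
      ?_ ?_
    · exact ((hH.continuous_fderiv one_ne_zero).comp
        (continuous_fst.prodMk (hg.comp continuous_snd))).aestronglyMeasurable
    · exact (Multivector.consTime (V := V) (m := m)).continuous.comp_aestronglyMeasurable
        hK.aestronglyMeasurable.comp_snd
  rw [IntegrableOn, volume_eq_prod, ← Measure.prod_restrict]
  have hbound : Integrable (fun q : ℝ × 𝔼 => C ^ (m + 1) * ‖K q.2‖)
      ((volume.restrict (Ioc (0 : ℝ) 1)).prod (volume.restrict E)) :=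
    (integrable_const (C ^ (m + 1))).mul_prod hK.norm
  refine Integrable.mono' hbound hmeasσ ?_
  rw [Measure.prod_restrict, ae_restrict_iff' (measurableSet_Ioc.prod hE)]
  refine Eventually.of_forall fun q hq => ?_
  calc ‖Multivector.push (m := m + 1) (fderiv ℝ H (q.1, g q.2)) (Multivector.consTime (K q.2))‖
      ≤ ‖fderiv ℝ H (q.1, g q.2)‖ ^ (m + 1) * ‖Multivector.consTime (K q.2)‖ :=
        Multivector.norm_push_le _ _
    _ ≤ C ^ (m + 1) * ‖K q.2‖ :=
        mul_le_mul (pow_le_pow_left₀ (norm_nonneg _) (hC q.1 hq.1 q.2 hq.2) _)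
          (Multivector.norm_consTime_le _) (norm_nonneg _) (by positivity)

omit [FiniteDimensional ℝ V'] [MeasurableSpace V'] [BorelSpace V'] in
/-- **Integrability of the product-piece density** on `ofLp ⁻¹' ((0,1] × E)`.
[cite: Federer1969, 4.1.30] -/
theorem integrableOn_prodPieceDensity_smul_frameVector (hH : ContDiff ℝ 1 H) (hg : Continuous g)
    (hE : MeasurableSet E) (hgd : ∀ u ∈ E, DifferentiableAt ℝ g u ∧ Injective (fderiv ℝ g u))
    (hgi : InjOn g E)
    (hframe : ∀ᵐ y ∂((μHE[m] : Measure V).restrict (g '' E)), ∀ u ∈ E, g u = y →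
      Orthonormal ℝ (ξ y) ∧ ((Submodule.span ℝ (range (ξ y)) : Set V) = range (fderiv ℝ g u)))
    {C : ℝ} (hC0 : 0 ≤ C) (hC : ∀ t ∈ Ioc (0 : ℝ) 1, ∀ u ∈ E, ‖fderiv ℝ H (t, g u)‖ ≤ C)
    (hG : IntegrableOn (fun y => (θ y : ℝ) • frameVector (ξ y)) (g '' E) (μHE[m] : Measure V)) :
    IntegrableOn (fun v : ℙ => (prodPieceDensity g θ ξ v : ℝ) •
      frameVector (fun k => prodDeriv H g v (prodBasis m k)))
      (ofLp ⁻¹' (Ioc (0 : ℝ) 1 ×ˢ E)) := by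
  have hmp := WithLp.volume_preserving_ofLp ℝ (EuclideanSpace ℝ (Fin m))
  have hemb : MeasurableEmbedding (ofLp : ℙ → ℝ × 𝔼) :=
    (MeasurableEquiv.toLp 2 (ℝ × 𝔼)).symm.measurableEmbedding
  have hK := integrableOn_normDet_smul_comp (θ := θ) (ξ := ξ) hE hgd hgi hG
  have hP := integrableOn_push_consTime hH hg hE hC0 hC hK
  -- transport to `ℙ` and compare a.e.
  have hP' := (hmp.integrableOn_comp_preimage hemb).2 hP
  refine hP'.congr_fun_ae ?_
  filter_upwards [ae_prodPieceDensity_smul_frameVector (H := H) (θ := θ) measurableSet_Ioc hE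
    hgd hgi hframe] with v hv
  rw [hv, comp_apply, map_smul, map_smul]

omit [FiniteDimensional ℝ V] [MeasurableSpace V] [BorelSpace V] [MeasurableSpace V'] [BorelSpace V']
  [FiniteDimensional ℝ V'] in
/-- Pointwise: the integrand of the push-forward of the product current, via `push ∘ consTime`:
`θ · ψ(H)(DH e₀, DH(0,ξ₁), …) = (push DH (consTime (θ • ξ)))(ψ(H))`. [folklore] -/
theorem mul_apply_cons_eq_push_consTime (ψ : V' → Covector V' (m + 1)) (t : ℝ) (x : V) :
    (θ x : ℝ) * ψ (H (t, x)) (fun k => fderiv ℝ H (t, x)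
        ((Fin.cons ((1 : ℝ), (0 : V)) (fun i => ((0 : ℝ), ξ x i)) : Fin (m + 1) → ℝ × V) k)) =
      Multivector.push (fderiv ℝ H (t, x))
        (Multivector.consTime ((θ x : ℝ) • frameVector (ξ x))) (ψ (H (t, x))) := by
  rw [map_smul, map_smul, _root_.smul_apply, smul_eq_mul,
    Multivector.push_consTime_frameVector, frameVector_apply]
  congr 2
  funext k
  refine Fin.cases ?_ (fun i => ?_) k <;> simp

omit [FiniteDimensional ℝ V'] [MeasurableSpace V'] [BorelSpace V'] in
/-- **The integral identity on a product piece**: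
`∫_{ofLp⁻¹((0,1]×E)} prodPieceDensity · ψ(Ĝ)(DĜ prodBasis) = ∫_{(0,1]×E} J(Dg u) θ ψ(H)(DH(e₀, (0,ξ)))`.
[cite: Federer1969, 4.1.30, 3.2.5] -/
theorem setIntegral_prodPiece_eq (hE : MeasurableSet E)
    (hgd : ∀ u ∈ E, DifferentiableAt ℝ g u ∧ Injective (fderiv ℝ g u)) (hgi : InjOn g E)
    (hframe : ∀ᵐ y ∂((μHE[m] : Measure V).restrict (g '' E)), ∀ u ∈ E, g u = y →
      Orthonormal ℝ (ξ y) ∧ ((Submodule.span ℝ (range (ξ y)) : Set V) = range (fderiv ℝ g u)))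
    (ψ : V' → Covector V' (m + 1)) :
    ∫ v in (ofLp ⁻¹' (Ioc (0 : ℝ) 1 ×ˢ E) : Set ℙ), (prodPieceDensity g θ ξ v : ℝ) *
        ψ (prodMap H g v) (fun k => prodDeriv H g v (prodBasis m k)) =
      ∫ q in Ioc (0 : ℝ) 1 ×ˢ E, (((fderiv ℝ g q.2 : 𝔼 →L[ℝ] V) : 𝔼 →ₗ[ℝ] V).normDet) *
        ((θ (g q.2) : ℝ) * ψ (H (q.1, g q.2)) (fun k => fderiv ℝ H (q.1, g q.2)
          ((Fin.cons ((1 : ℝ), (0 : V)) (fun i => ((0 : ℝ), ξ (g q.2) i)) : Fin (m + 1) → ℝ × V)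
            k))) := by
  have hmp := WithLp.volume_preserving_ofLp ℝ (EuclideanSpace ℝ (Fin m))
  have hemb : MeasurableEmbedding (ofLp : ℙ → ℝ × 𝔼) :=
    (MeasurableEquiv.toLp 2 (ℝ × 𝔼)).symm.measurableEmbedding
  set F : ℝ × 𝔼 → ℝ := fun q => (pieceDensity g θ ξ q.2 : ℝ) *
    ψ (H (q.1, g q.2)) (fun k => prodDeriv H g (toLp 2 q) (prodBasis m k)) with hF
  have h1 : (fun v : ℙ => (prodPieceDensity g θ ξ v : ℝ) *
      ψ (prodMap H g v) (fun k => prodDeriv H g v (prodBasis m k))) = fun v => F (ofLp v) := by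
    funext v
    simp [hF, prodPieceDensity, prodMap]
  rw [h1, hmp.setIntegral_preimage_emb hemb F]
  refine setIntegral_congr_ae (measurableSet_Ioc.prod hE) ?_
  filter_upwards [(ae_restrict_iff' (measurableSet_Ioc.prod hE)).1
    (ae_pieceDensity_smul_frameVector_prod (H := H) (θ := θ) measurableSet_Ioc hE hgd hgi hframe)]
    with q hq hqmem
  have := congrArg (fun w : Multivector V' (m + 1) => w (ψ (H (q.1, g q.2)))) (hq hqmem)
  simp only [_root_.smul_apply, frameVector_apply, smul_eq_mul] at this
  rw [hF]
  dsimp only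
  rw [this, mul_apply_cons_eq_push_consTime (θ := θ) (ξ := ξ) (H := H) ψ]

omit [FiniteDimensional ℝ V'] [MeasurableSpace V'] [BorelSpace V'] in
/-- **The mass bound on a product piece**:
`∫_{ofLp⁻¹((0,1]×E)} ‖prodPieceDensity • DĜ prodBasis‖ ≤ C^{m+1} ∫_{g(E)} ‖θ • ξ‖ d𝓗^m`
(`vol (0,1] = 1`). [cite: Federer1969, 4.1.30] -/
theorem lintegral_prodPiece_le (hE : MeasurableSet E)
    (hgd : ∀ u ∈ E, DifferentiableAt ℝ g u ∧ Injective (fderiv ℝ g u)) (hgi : InjOn g E)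
    (hframe : ∀ᵐ y ∂((μHE[m] : Measure V).restrict (g '' E)), ∀ u ∈ E, g u = y →
      Orthonormal ℝ (ξ y) ∧ ((Submodule.span ℝ (range (ξ y)) : Set V) = range (fderiv ℝ g u)))
    (hG : IntegrableOn (fun y => (θ y : ℝ) • frameVector (ξ y)) (g '' E) (μHE[m] : Measure V))
    {C : ℝ} (hC0 : 0 ≤ C) (hC : ∀ t ∈ Ioc (0 : ℝ) 1, ∀ u ∈ E, ‖fderiv ℝ H (t, g u)‖ ≤ C) :
    ∫⁻ v in (ofLp ⁻¹' (Ioc (0 : ℝ) 1 ×ˢ E) : Set ℙ), ‖(prodPieceDensity g θ ξ v : ℝ) •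
        frameVector (fun k => prodDeriv H g v (prodBasis m k))‖ₑ ≤
      ENNReal.ofReal (C ^ (m + 1)) *
        ∫⁻ y in g '' E, ‖(θ y : ℝ) • frameVector (ξ y)‖ₑ ∂(μHE[m] : Measure V) := by
  have hmp := WithLp.volume_preserving_ofLp ℝ (EuclideanSpace ℝ (Fin m))
  have hemb : MeasurableEmbedding (ofLp : ℙ → ℝ × 𝔼) :=
    (MeasurableEquiv.toLp 2 (ℝ × 𝔼)).symm.measurableEmbedding
  have hgd' : ∀ u ∈ E, HasFDerivWithinAt g (fderiv ℝ g u) E u := fun u hu =>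
    (hgd u hu).1.hasFDerivAt.hasFDerivWithinAt
  have hinj' : ∀ u ∈ E, Injective (fderiv ℝ g u) := fun u hu => (hgd u hu).2
  set K : 𝔼 → Multivector V m := fun u => (((fderiv ℝ g u : 𝔼 →L[ℝ] V) : 𝔼 →ₗ[ℝ] V).normDet) •
    ((θ (g u) : ℝ) • frameVector (ξ (g u))) with hKdef
  have hK : IntegrableOn K E := integrableOn_normDet_smul_comp (θ := θ) (ξ := ξ) hE hgd hgi hG
  -- transport to `ℝ × ℝᵐ`
  set F : ℝ × 𝔼 → ℝ≥0∞ := fun q => ‖(pieceDensity g θ ξ q.2 : ℝ) •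
    frameVector (fun k => prodDeriv H g (toLp 2 q) (prodBasis m k))‖ₑ with hF
  have h1 : (fun v : ℙ => ‖(prodPieceDensity g θ ξ v : ℝ) •
      frameVector (fun k => prodDeriv H g v (prodBasis m k))‖ₑ) = fun v => F (ofLp v) := by
    funext v
    simp [hF, prodPieceDensity]
  rw [h1, hmp.setLIntegral_comp_preimage_emb hemb F]
  -- the pointwise bound `F ≤ C^{m+1} ‖K‖` a.e. on `(0,1] × E`
  have h2 : ∫⁻ q in Ioc (0 : ℝ) 1 ×ˢ E, F q ≤
      ∫⁻ q in Ioc (0 : ℝ) 1 ×ˢ E, ENNReal.ofReal (C ^ (m + 1)) * ‖K q.2‖ₑ := by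
    refine lintegral_mono_ae ?_
    filter_upwards [ae_pieceDensity_smul_frameVector_prod (H := H) (θ := θ) measurableSet_Ioc hE
      hgd hgi hframe, ae_restrict_mem (measurableSet_Ioc.prod hE)] with q hq hqmem
    rw [hF]
    dsimp only
    rw [hq, ← map_smul, ← map_smul, ← ofReal_norm, ← ofReal_norm,
      ← ENNReal.ofReal_mul (by positivity)]
    refine ENNReal.ofReal_le_ofReal ?_
    calc ‖Multivector.push (m := m + 1) (fderiv ℝ H (q.1, g q.2)) (Multivector.consTime (K q.2))‖
        ≤ ‖fderiv ℝ H (q.1, g q.2)‖ ^ (m + 1) * ‖Multivector.consTime (K q.2)‖ :=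
          Multivector.norm_push_le _ _
      _ ≤ C ^ (m + 1) * ‖K q.2‖ :=
          mul_le_mul (pow_le_pow_left₀ (norm_nonneg _) (hC q.1 hqmem.1 q.2 hqmem.2) _)
            (Multivector.norm_consTime_le _) (norm_nonneg _) (by positivity)
  refine h2.trans ?_
  rw [lintegral_const_mul' _ _ ENNReal.ofReal_ne_top]
  gcongr
  -- `∫_{(0,1] × E} ‖K q.2‖ = vol (0,1] · ∫_E ‖K‖ = ∫_{g(E)} ‖θ • ξ‖`
  have hKm : AEMeasurable (fun q : ℝ × 𝔼 => ‖K q.2‖ₑ)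
      ((volume.restrict (Ioc (0 : ℝ) 1)).prod (volume.restrict E)) :=
    (hK.aestronglyMeasurable.comp_snd (μ := volume.restrict (Ioc (0 : ℝ) 1))).enorm
  rw [volume_eq_prod, ← Measure.prod_restrict, lintegral_prod _ hKm]
  simp only [lintegral_const, Measure.restrict_apply MeasurableSet.univ, univ_inter,
    Real.volume_Ioc, sub_zero, ENNReal.ofReal_one, mul_one]
  refine le_of_eq ?_
  have h3 := lintegral_image_eq_lintegral_normDet_mul hE hgd' hinj' hgi
    (fun y => ‖(θ y : ℝ) • frameVector (ξ y)‖ₑ)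
  rw [finrank_euclideanSpace_fin] at h3
  rw [h3]
  refine setLIntegral_congr_fun hE fun u hu => ?_
  rw [hKdef]
  dsimp only
  rw [enorm_smul, Real.enorm_eq_ofReal (LinearMap.normDet_nonneg _)]

/-! #### The image current of a sub-piece of a product piece -/

omit [FiniteDimensional ℝ V] [MeasurableSpace V] [BorelSpace V] in
/-- **Sub-piece image currents of product pieces**: on a measurable `Q ⊆ ofLp ⁻¹' (ℝ × E)`
where `Ĝ` has injective differential and is Lipschitz and anti-Lipschitz, the current
`[Ĝ(Q), prodPieceDensity ∘ Ĝ⁻¹, GS(DĜ prodBasis)]` has admissible rectifiable data, the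
parameter-side formula, and mass `≤ ∫_Q ‖prodPieceDensity • DĜ prodBasis‖`.
[cite: Federer1969, 4.1.28, 4.1.30] -/
theorem prod_subpiece_current
    (hgd : ∀ u ∈ E, DifferentiableAt ℝ g u ∧ Injective (fderiv ℝ g u))
    (hH : ContDiff ℝ 1 H) {Q : Set ℙ} (hQm : MeasurableSet Q) (hQE : ∀ v ∈ Q, (ofLp v).2 ∈ E)
    (hFinj : ∀ v ∈ Q, Injective (prodDeriv H g v))
    {K' : ℝ≥0} (hFanti : AntilipschitzWith K' (Q.restrict (prodMap H g))) {L' : ℝ≥0}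
    (hFlip : LipschitzOnWith L' (prodMap H g) Q)
    (hint : IntegrableOn (fun v : ℙ => (prodPieceDensity g θ ξ v : ℝ) •
      frameVector (fun k => prodDeriv H g v (prodBasis m k))) Q) :
    IsRectifiableData (⊤ : Opens V') (m + 1) (prodMap H g '' Q)
        (imageDensity (prodMap H g) Q (prodPieceDensity g θ ξ))
        (imageFrame (prodMap H g) (prodDeriv H g) Q (prodBasis m)) ∧
      (∀ ψ : TestForm (⊤ : Opens V') (m + 1),
        (currentOfIntegration (prodMap H g '' Q) (imageDensity (prodMap H g) Q (prodPieceDensity g θ ξ))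
          (imageFrame (prodMap H g) (prodDeriv H g) Q (prodBasis m)) :
            Current (⊤ : Opens V') (m + 1)) ψ =
          ∫ v in Q, (prodPieceDensity g θ ξ v : ℝ) *
            ψ (prodMap H g v) (fun k => prodDeriv H g v (prodBasis m k))) ∧
      (currentOfIntegration (prodMap H g '' Q) (imageDensity (prodMap H g) Q (prodPieceDensity g θ ξ))
          (imageFrame (prodMap H g) (prodDeriv H g) Q (prodBasis m)) :
            Current (⊤ : Opens V') (m + 1)).mass ≤
        ∫⁻ v in Q, ‖(prodPieceDensity g θ ξ v : ℝ) •
          frameVector (fun k => prodDeriv H g v (prodBasis m k))‖ₑ := by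
  have hn : finrank ℝ ℙ = m + 1 := finrank_eq_of_orthonormalBasis_fin (prodBasis m)
  have hFd : ∀ v ∈ Q, HasFDerivWithinAt (prodMap H g) (prodDeriv H g v) Q v := fun v hv =>
    (hasFDerivAt_prodMap hH (hgd _ (hQE v hv)).1).hasFDerivWithinAt
  have hFi : InjOn (prodMap H g) Q := fun a ha b hb h => by
    have := hFanti.injective (a₁ := ⟨a, ha⟩) (a₂ := ⟨b, hb⟩) (by simpa using h)
    exact congrArg Subtype.val this
  refine ⟨isRectifiableData_image_density' (prodBasis m) hQm hFd hFinj hFanti hFlip hint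
    (subset_univ _), fun ψ => currentOfIntegration_image_density_apply hQm hFd hFinj hFi _ hint ψ, ?_⟩
  refine (mass_vectorCurrent_le _ _).trans (le_of_eq ?_)
  have h := lintegral_image_eq_lintegral_normDet_mul hQm hFd hFinj hFi
    (fun z => ‖(imageDensity (prodMap H g) Q (prodPieceDensity g θ ξ) z : ℝ) •
      frameVector (imageFrame (prodMap H g) (prodDeriv H g) Q (prodBasis m) z)‖ₑ)
  rw [hn] at h
  rw [h]
  refine setLIntegral_congr_fun hQm fun v hv => ?_
  rw [← Real.enorm_eq_ofReal (LinearMap.normDet_nonneg _), ← enorm_smul,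
    normDet_smul_imageDensity_smul_frameVector hFinj hFi (prodBasis m) _ hv]

end ProdPiece

/-! ### The theorem -/

section Main

variable {V : Type*} [NormedAddCommGroup V] [InnerProductSpace ℝ V] [FiniteDimensional ℝ V]
  [MeasurableSpace V] [BorelSpace V]
  {V' : Type*} [NormedAddCommGroup V'] [InnerProductSpace ℝ V'] [FiniteDimensional ℝ V']
  [MeasurableSpace V'] [BorelSpace V'] {m : ℕ}

local notation "𝔼" => EuclideanSpace ℝ (Fin m)
local notation "𝕖" => EuclideanSpace.basisFun (Fin m) ℝ
local notation "ℙ" => WithLp 2 (ℝ × EuclideanSpace ℝ (Fin m))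

-- The bookkeeping of the doubly-indexed sub-pieces (`simp` with `Nat.unpair_pair`) is heavy.
set_option maxHeartbeats 800000 in
/-- **`H_#([0,1] × T)` is rectifiable** for `T ∈ 𝓡_m(V)` with compact support, `H : ℝ × V → V'`
smooth and a cutoff `χ` equal to `1` on `[0,1] × spt T`. See the module docstring for the proof.
[cite: Federer1969, 4.1.9, 4.1.30] -/
theorem Current.IsRectifiable.pushforward_prodInterval_top {T : Current (⊤ : Opens V) m}
    (hT : T.IsRectifiable) (χ : 𝓓(cylinder (⊤ : Opens V), ℝ))
    (hχ : ∀ p ∈ Icc (0 : ℝ) 1 ×ˢ T.support, χ p = 1) {H : ℝ × V → V'} (hH : ContDiff ℝ ∞ H) :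
    ((T.prodInterval 0 1).pushforward (⊤ : Opens V') χ hH).IsRectifiable := by
  classical
  have hH1 : ContDiff ℝ 1 H := hH.of_le (by simp)
  have hHd : Differentiable ℝ H := hH.differentiable (by simp)
  /- Step 0: data carried by `K = spt T`, of finite measure. -/
  have hK : IsCompact T.support := hT.2
  obtain ⟨W, θ, ξ, hd, hTeq, hWK, hWfin, -⟩ := hT.exists_data_subset hK Subset.rfl
  have hWm : MeasurableSet W := hd.1
  set μ : Measure V := (μHE[m] : Measure V) with hμ
  set G : V → Multivector V m := fun y => (θ y : ℝ) • frameVector (ξ y) with hGdef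
  have hGint : IntegrableOn G W μ := by
    have h1 : IntegrableOn G T.support (μ.restrict W) :=
      hd.2.2.2.1.integrableOn_compact_subset (subset_univ _) hK
    have : (μ.restrict W).restrict T.support = μ.restrict W := by
      rw [Measure.restrict_restrict hK.isClosed.measurableSet, inter_eq_right.2 hWK]
    rw [IntegrableOn, this] at h1
    exact h1
  haveI hWfinI : IsFiniteMeasure (μ.restrict W) :=
    ⟨by rw [Measure.restrict_apply_univ]; exact hWfin⟩
  -- bounds for `DH` on `[0,1] × K` and on `[0,1] × 𝐁(0, ρ)` (where `H` is then Lipschitz)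
  have hIK : IsCompact (Icc (0 : ℝ) 1 ×ˢ T.support) := isCompact_Icc.prod hK
  obtain ⟨C', hC'⟩ := hIK.exists_bound_of_continuousOn
    ((hH.continuous_fderiv (by simp)).continuousOn)
  set C : ℝ := max C' 0 with hCdef
  have hC0 : 0 ≤ C := le_max_right _ _
  have hC : ∀ t ∈ Ioc (0 : ℝ) 1, ∀ y ∈ W, ‖fderiv ℝ H (t, y)‖ ≤ C := fun t ht y hy =>
    (hC' (t, y) ⟨Ioc_subset_Icc_self ht, hWK hy⟩).trans (le_max_left _ _)
  obtain ⟨ρ, hρ⟩ := hK.isBounded.subset_closedBall 0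
  have hB : IsCompact (Icc (0 : ℝ) 1 ×ˢ Metric.closedBall (0 : V) ρ) :=
    isCompact_Icc.prod (isCompact_closedBall 0 ρ)
  obtain ⟨C₁, hC₁⟩ := hB.exists_bound_of_continuousOn ((hH.continuous_fderiv (by simp)).continuousOn)
  have hHlip : LipschitzOnWith (Real.toNNReal C₁) H (Icc (0 : ℝ) 1 ×ˢ Metric.closedBall (0 : V) ρ) :=
    ((convex_Icc (0 : ℝ) 1).prod (convex_closedBall (0 : V) ρ)).lipschitzOnWith_of_nnnorm_fderiv_le
      (𝕜 := ℝ) (fun x _ => hHd x) fun x hx => by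
        rw [← NNReal.coe_le_coe, coe_nnnorm]
        exact (hC₁ x hx).trans (Real.le_coe_toNNReal C₁)
  /- Step 1: bi-Lipschitz pieces of the data. -/
  obtain ⟨E, g, L, Kg, hEm, hgL, hgK, hgd, hgW, hgm, hdisj, hnull, hframe⟩ := hd.exists_pieces
  have hgi : ∀ j, InjOn (g j) (E j) := fun j => injOn_of_antilipschitz_restrict (hgK j)
  have hfinj : ∀ j, IsFiniteMeasure (μ.restrict (g j '' E j)) := fun j =>
    ⟨by rw [Measure.restrict_apply_univ]; exact (measure_mono (hgW j)).trans_lt hWfin⟩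
  haveI : ∀ j, SFinite (μ.restrict (g j '' E j)) := fun j => by
    haveI := hfinj j; infer_instance
  have hCj : ∀ j, ∀ t ∈ Ioc (0 : ℝ) 1, ∀ u ∈ E j, ‖fderiv ℝ H (t, g j u)‖ ≤ C :=
    fun j t ht u hu => hC t ht _ (hgW j ⟨u, hu, rfl⟩)
  have hint : ∀ j, IntegrableOn (fun v : ℙ => (prodPieceDensity (g j) θ ξ v : ℝ) •
      frameVector (fun k => prodDeriv H (g j) v (prodBasis m k)))
      (ofLp ⁻¹' (Ioc (0 : ℝ) 1 ×ˢ E j)) := fun j =>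
    integrableOn_prodPieceDensity_smul_frameVector hH1 (hgL j).continuous (hEm j) (hgd j) (hgi j)
      (hframe j) hC0 (hCj j) (hGint.mono_set (hgW j))
  /- Step 2: sub-pieces on which `F j = prodMap H (g j)` is anti-Lipschitz. -/
  have hsub := fun j => exists_antilipschitz_pieces (g := prodMap H (g j))
  choose t Kt htm htdisj htS hSt htK using hsub
  let Q : ℕ → Set ℙ := fun j => ofLp ⁻¹' (Ioc (0 : ℝ) 1 ×ˢ E j)
  have hQm : ∀ j, MeasurableSet (Q j) := fun j =>
    (MeasurableEquiv.toLp 2 (ℝ × 𝔼)).symm.measurable (measurableSet_Ioc.prod (hEm j))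
  have hFd : ∀ j, ∀ v ∈ Q j, DifferentiableAt ℝ (prodMap H (g j)) v ∧
      fderiv ℝ (prodMap H (g j)) v = prodDeriv H (g j) v := fun j v hv =>
    ⟨(hasFDerivAt_prodMap hH1 (hgd j _ hv.2).1).differentiableAt,
      (hasFDerivAt_prodMap hH1 (hgd j _ hv.2).1).fderiv⟩
  -- indexing of the sub-pieces `(j, n)` by `k : ℕ`
  let jj : ℕ → ℕ := fun k => k.unpair.1
  let nn : ℕ → ℕ := fun k => k.unpair.2
  let E' : ℕ → Set ℙ := fun k => Q (jj k) ∩ t (jj k) (nn k)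
  have hE'm : ∀ k, MeasurableSet (E' k) := fun k => (hQm _).inter (htm _ _)
  have hE'E : ∀ k, ∀ v ∈ E' k, (ofLp v).2 ∈ E (jj k) := fun k v hv => hv.1.2
  have hFinj : ∀ k, ∀ v ∈ E' k, Injective (prodDeriv H (g (jj k)) v) := fun k v hv => by
    rw [← (hFd _ v hv.1).2]
    exact (htS _ _ hv.2).2
  have hFanti : ∀ k, AntilipschitzWith (Kt (jj k) (nn k)) ((E' k).restrict (prodMap H (g (jj k)))) :=
    fun k => (htK _ _).restrict_mono inter_subset_right
  -- `F j` is Lipschitz on `Q j`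
  have hinner : ∀ j, LipschitzWith (max 1 (L j * 1)) fun q : ℝ × 𝔼 => (q.1, g j q.2) := fun j =>
    LipschitzWith.prod_fst.prodMk ((hgL j).comp LipschitzWith.prod_snd)
  have hmaps : ∀ j, MapsTo (fun v : ℙ => ((ofLp v).1, g j (ofLp v).2)) (Q j)
      (Icc (0 : ℝ) 1 ×ˢ Metric.closedBall (0 : V) ρ) := fun j v hv =>
    ⟨Ioc_subset_Icc_self hv.1, hρ (hWK (hgW j ⟨_, hv.2, rfl⟩))⟩
  have hFlip : ∀ k, LipschitzOnWith (Real.toNNReal C₁ * (max 1 (L (jj k) * 1) * 1))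
      (prodMap H (g (jj k))) (E' k) := fun k => by
    have h1 : LipschitzWith (max 1 (L (jj k) * 1) * 1)
        fun v : ℙ => ((ofLp v).1, g (jj k) (ofLp v).2) :=
      (hinner (jj k)).comp (prod_lipschitzWith_ofLp 2 ℝ 𝔼)
    exact (hHlip.comp h1.lipschitzOnWith (hmaps (jj k))).mono inter_subset_left
  -- the sub-piece currents and their properties
  have hR := fun k => prod_subpiece_current (θ := θ) (ξ := ξ) (hgd (jj k)) hH1 (hE'm k) (hE'E k)
    (hFinj k) (hFanti k) (hFlip k) ((hint _).mono_set inter_subset_left)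
  set R : ℕ → Current (⊤ : Opens V') (m + 1) := fun k =>
    currentOfIntegration (prodMap H (g (jj k)) '' E' k)
      (imageDensity (prodMap H (g (jj k))) (E' k) (prodPieceDensity (g (jj k)) θ ξ))
      (imageFrame (prodMap H (g (jj k))) (prodDeriv H (g (jj k))) (E' k) (prodBasis m)) with hRdef
  have hHK : IsCompact (H '' (Icc (0 : ℝ) 1 ×ˢ T.support)) := hIK.image hH.continuous
  have hRK : ∀ k, (R k).support ⊆ H '' (Icc (0 : ℝ) 1 ×ˢ T.support) := fun k => by
    refine (support_currentOfIntegration_subset_closure _ _ _).trans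
      (closure_minimal ?_ hHK.isClosed)
    rintro _ ⟨v, hv, rfl⟩
    exact ⟨((ofLp v).1, g (jj k) (ofLp v).2), ⟨Ioc_subset_Icc_self hv.1.1,
      hWK (hgW _ ⟨_, hv.1.2, rfl⟩)⟩, rfl⟩
  have hRrect : ∀ k, (R k).IsRectifiable := fun k =>
    ⟨⟨_, _, _, (hR k).1, rfl⟩, Current.isCompact_support_of_subset _ hHK (subset_univ _) (hRK k)⟩
  /- Step 3: the masses are summable. -/
  let a : ℕ → ℝ≥0∞ := fun k => ∫⁻ v in E' k, ‖(prodPieceDensity (g (jj k)) θ ξ v : ℝ) •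
    frameVector (fun i => prodDeriv H (g (jj k)) v (prodBasis m i))‖ₑ
  have hmass : ∀ k, (R k).mass ≤ a k := fun k => (hR k).2.2
  let b : ℕ → ℕ → ℝ≥0∞ := fun j n => ∫⁻ v in Q j ∩ t j n, ‖(prodPieceDensity (g j) θ ξ v : ℝ) •
    frameVector (fun i => prodDeriv H (g j) v (prodBasis m i))‖ₑ
  have hab : ∀ p : ℕ × ℕ, a (Nat.pairEquiv p) = b p.1 p.2 := by
    rintro ⟨j, n⟩
    simp only [a, b, E', jj, nn, Nat.pairEquiv_apply, Function.uncurry_apply_pair, Nat.unpair_pair]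
  have hbj : ∀ j, ∑' n, b j n ≤ ENNReal.ofReal (C ^ (m + 1)) * ∫⁻ y in g j '' E j, ‖G y‖ₑ ∂μ := by
    intro j
    have h1 : ∑' n, b j n = ∫⁻ v in ⋃ n, Q j ∩ t j n, ‖(prodPieceDensity (g j) θ ξ v : ℝ) •
        frameVector (fun i => prodDeriv H (g j) v (prodBasis m i))‖ₑ := by
      rw [lintegral_iUnion (fun n => (hQm j).inter (htm j n))
        (fun n n' h => (htdisj j h).mono inter_subset_right inter_subset_right)]
    rw [h1]
    refine (lintegral_mono_set (iUnion_subset fun n => inter_subset_left)).trans ?_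
    exact lintegral_prodPiece_le (hEm j) (hgd j) (hgi j) (hframe j) (hGint.mono_set (hgW j)) hC0 (hCj j)
  have hsumG : ∑' j, ∫⁻ y in g j '' E j, ‖G y‖ₑ ∂μ ≤ ∫⁻ y in W, ‖G y‖ₑ ∂μ := by
    rw [← lintegral_iUnion hgm hdisj]
    exact lintegral_mono_set (iUnion_subset hgW)
  have hGfin : ∫⁻ y in W, ‖G y‖ₑ ∂μ < ⊤ := hGint.2
  have hsum : ∑' k, a k ≠ ⊤ := by
    have h1 : ∑' k, a k = ∑' p : ℕ × ℕ, b p.1 p.2 := by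
      rw [← Nat.pairEquiv.tsum_eq]
      exact tsum_congr hab
    rw [h1, ENNReal.tsum_prod]
    refine ne_top_of_le_ne_top ?_ (ENNReal.tsum_le_tsum hbj)
    rw [ENNReal.tsum_mul_left]
    exact ENNReal.mul_ne_top ENNReal.ofReal_ne_top (ne_top_of_le_ne_top hGfin.ne hsumG)
  have hsum' : ∑' k, (R k).mass ≠ ⊤ := ne_top_of_le_ne_top hsum (ENNReal.tsum_le_tsum hmass)
  /- Step 4: the `𝐌`-limit of the partial sums. -/
  set S : ℕ → Current (⊤ : Opens V') (m + 1) := fun N => ∑ k ∈ Finset.range N, R k with hSdef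
  have hSrect : ∀ N, (S N).IsRectifiable := fun N => Current.IsRectifiable.finset_sum_top R hRrect N
  have hSK : ∀ N, (S N).support ⊆ H '' (Icc (0 : ℝ) 1 ×ˢ T.support) := fun N =>
    Current.support_finset_sum_subset R hRK N
  have hSdiff : ∀ N, S (N + 1) - S N = R N := fun N => by
    simp only [hSdef, Finset.sum_range_succ, add_sub_cancel_left]
  obtain ⟨T', hT'rect, -, hT'lim⟩ := Current.IsRectifiable.exists_limit_of_tsum_mass_ne_top
    hHK S hSrect hSK (by simpa only [hSdiff] using hsum')
  /- Step 5: identification `H_# ([0,1] × T) = T'`. -/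
  suffices heq : (T.prodInterval 0 1).pushforward (⊤ : Opens V') χ hH = T' by rw [heq]; exact hT'rect
  ext ψ
  obtain ⟨c₀, hc₀⟩ := ψ.hasCompactSupport.exists_bound_of_continuous ψ.continuous
  set c : ℝ := max c₀ 0 + 1 with hcdef
  have hc : 0 < c := by positivity
  have hψc : ∀ z, ‖ψ z‖ ≤ c := fun z => (hc₀ z).trans (by
    rw [hcdef]; linarith [le_max_left c₀ 0])
  -- (a) `S N ψ → T' ψ`
  have hlim1 : Tendsto (fun N => S N ψ) atTop (𝓝 (T' ψ)) := by
    have hfin : ∀ᶠ N in atTop, (S N - T').mass < 1 := hT'lim.eventually (gt_mem_nhds one_pos)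
    have htoReal : Tendsto (fun N => ((S N - T').mass).toReal) atTop (𝓝 0) := by
      have := (ENNReal.tendsto_toReal ENNReal.zero_ne_top).comp hT'lim
      simpa only [Function.comp_def, ENNReal.toReal_zero] using this
    rw [tendsto_iff_norm_sub_tendsto_zero]
    refine squeeze_zero' (Eventually.of_forall fun N => norm_nonneg _) ?_
      (by simpa using htoReal.const_mul c)
    filter_upwards [hfin] with N hN
    rw [Real.norm_eq_abs, ← _root_.sub_apply]
    exact Current.abs_apply_le_mul_toReal_mass _ hN.ne_top hc hψc
  -- (b) `S N ψ → Σₖ R k ψ`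
  have hRψ : Summable fun k => R k ψ := by
    have ha : ∀ k, a k ≠ ⊤ := fun k => ne_top_of_le_ne_top hsum (ENNReal.le_tsum k)
    refine Summable.of_norm_bounded (g := fun k => c * (a k).toReal)
      ((ENNReal.summable_toReal hsum).mul_left c) fun k => ?_
    rw [Real.norm_eq_abs]
    refine (Current.abs_apply_le_mul_toReal_mass _ (ne_top_of_le_ne_top (ha k) (hmass k)) hc
      hψc).trans ?_
    gcongr
    · exact ha k
    · exact hmass k
  have hlim2 : Tendsto (fun N => S N ψ) atTop (𝓝 (∑' k, R k ψ)) := by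
    have : (fun N => S N ψ) = fun N => ∑ k ∈ Finset.range N, R k ψ := by
      funext N
      simp only [hSdef, FunLike.coe_sum, Finset.sum_apply]
    rw [this]
    exact hRψ.hasSum.tendsto_sum_nat
  have hT'ψ : T' ψ = ∑' k, R k ψ := tendsto_nhds_unique hlim1 hlim2
  rw [hT'ψ]
  /- (c) `H_#([0,1]×T) ψ = Σₖ R k ψ`: Fubini and the decomposition over the pieces. -/
  -- the integrand
  set Φ : ℝ × V → ℝ := fun q => (θ q.2 : ℝ) * ψ (H q) (fun k => fderiv ℝ H q
    ((Fin.cons ((1 : ℝ), (0 : V)) (fun i => ((0 : ℝ), ξ q.2 i)) : Fin (m + 1) → ℝ × V) k))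
    with hΦdef
  have hΦ_eq : ∀ q : ℝ × V, Φ q = Multivector.push (fderiv ℝ H q)
      (Multivector.consTime ((θ q.2 : ℝ) • frameVector (ξ q.2))) (ψ (H q)) := by
    rintro ⟨t', x⟩
    exact mul_apply_cons_eq_push_consTime (θ := θ) (ξ := ξ) (H := H) ψ t' x
  -- the push-forward as an iterated integral
  have hpush : (T.prodInterval 0 1).pushforward (⊤ : Opens V') χ hH ψ =
      ∫ t' in Ioc (0 : ℝ) 1, ∫ x in W, Φ (t', x) ∂μ := by
    rw [Current.pushforward_apply, Current.prodInterval_apply,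
      intervalIntegral.integral_of_le zero_le_one]
    refine setIntegral_congr_fun measurableSet_Ioc fun t' ht' => ?_
    rw [hTeq, currentOfIntegration_apply hd.2.2.2.1]
    refine setIntegral_congr_fun hWm fun x hx => ?_
    rw [TestForm.tslice_apply, TestForm.pullback_apply, covSlice_smul,
      hχ (t', x) ⟨Ioc_subset_Icc_self ht', hWK hx⟩, one_smul, covSlice_apply,
      ContinuousAlternatingMap.compContinuousLinearMap_apply]
    rfl
  -- `Φ` is integrable for `ν = (vol ⌞ (0,1]) × (μ ⌞ W)`
  set ν : Measure (ℝ × V) := (volume.restrict (Ioc (0 : ℝ) 1)).prod (μ.restrict W) with hν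
  have hΦint : Integrable Φ ν := by
    have hA : AEStronglyMeasurable (fun q : ℝ × V => Multivector.push (m := m + 1) (fderiv ℝ H q)
        (Multivector.consTime ((θ q.2 : ℝ) • frameVector (ξ q.2)))) ν := by
      refine Continuous.comp_aestronglyMeasurable₂ (g := fun (A : (ℝ × V) →L[ℝ] V')
        (w : Multivector (ℝ × V) (m + 1)) => Multivector.push A w) Multivector.continuous_push_uncurry
        ((hH.continuous_fderiv (by simp)).aestronglyMeasurable) ?_
      exact (Multivector.consTime (V := V) (m := m)).continuous.comp_aestronglyMeasurable
        (hGint.aestronglyMeasurable.comp_snd)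
    have hmeas : AEStronglyMeasurable Φ ν := by
      have h2 : Continuous fun p : Multivector V' (m + 1) × Covector V' (m + 1) => p.1 p.2 :=
        isBoundedBilinearMap_apply.continuous
      refine (h2.comp_aestronglyMeasurable (hA.prodMk
        ((ψ.continuous.comp hH.continuous).aestronglyMeasurable))).congr
        (Eventually.of_forall fun q => ?_)
      simp only [comp_apply]
      exact (hΦ_eq q).symm
    have hbound : Integrable (fun q : ℝ × V => c * (C ^ (m + 1) * ‖G q.2‖)) ν :=
      (integrable_const c).mul_prod ((hGint.norm).const_mul (C ^ (m + 1)))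
    refine Integrable.mono' hbound hmeas ?_
    have hmem : ∀ᵐ q ∂ν, q ∈ Ioc (0 : ℝ) 1 ×ˢ W := by
      have h1 : ∀ᵐ q ∂ν, q.1 ∈ Ioc (0 : ℝ) 1 :=
        (quasiMeasurePreserving_fst (μ := volume.restrict (Ioc (0 : ℝ) 1))
          (ν := μ.restrict W)).ae (ae_restrict_mem measurableSet_Ioc)
      have h2 : ∀ᵐ q ∂ν, q.2 ∈ W :=
        (quasiMeasurePreserving_snd (μ := volume.restrict (Ioc (0 : ℝ) 1))
          (ν := μ.restrict W)).ae (ae_restrict_mem hWm)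
      filter_upwards [h1, h2] with q h1 h2 using ⟨h1, h2⟩
    filter_upwards [hmem] with q hq
    rw [hΦ_eq q, Real.norm_eq_abs]
    calc |Multivector.push (fderiv ℝ H q) (Multivector.consTime ((θ q.2 : ℝ) • frameVector (ξ q.2)))
          (ψ (H q))|
        ≤ ‖Multivector.push (m := m + 1) (fderiv ℝ H q)
            (Multivector.consTime ((θ q.2 : ℝ) • frameVector (ξ q.2)))‖ * ‖ψ (H q)‖ :=
          (Real.norm_eq_abs _) ▸ ContinuousLinearMap.le_opNorm _ _
      _ ≤ (‖fderiv ℝ H q‖ ^ (m + 1) * ‖Multivector.consTime ((θ q.2 : ℝ) • frameVector (ξ q.2))‖) *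
            c := mul_le_mul (Multivector.norm_push_le _ _) (hψc _) (norm_nonneg _) (by positivity)
      _ ≤ (C ^ (m + 1) * ‖G q.2‖) * c := by
          refine mul_le_mul_of_nonneg_right (mul_le_mul (pow_le_pow_left₀ (norm_nonneg _) ?_ _)
            (Multivector.norm_consTime_le _) (norm_nonneg _) (by positivity)) hc.le
          have := hC q.1 hq.1 q.2 hq.2
          exact this
      _ = c * (C ^ (m + 1) * ‖G q.2‖) := by ring
  have hpush' : (T.prodInterval 0 1).pushforward (⊤ : Opens V') χ hH ψ = ∫ q, Φ q ∂ν := by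
    rw [hpush, hν, integral_prod Φ hΦint]
  rw [hpush']
  -- decomposition of `ν` over the pieces
  have hUW : (⋃ j, g j '' E j) ⊆ W := iUnion_subset hgW
  have hWae : (⋃ j, g j '' E j) =ᵐ[μ] W := by
    refine ae_eq_of_subset_of_measure_ge hUW ?_ (MeasurableSet.iUnion hgm).nullMeasurableSet
      hWfin.ne
    calc μ W ≤ μ ((⋃ j, g j '' E j) ∪ (W \ ⋃ j, g j '' E j)) := by rw [union_sdiff_cancel hUW]
      _ ≤ μ (⋃ j, g j '' E j) + μ (W \ ⋃ j, g j '' E j) := measure_union_le _ _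
      _ = μ (⋃ j, g j '' E j) := by rw [hnull, add_zero]
  set νj : ℕ → Measure (ℝ × V) := fun j =>
    (volume.restrict (Ioc (0 : ℝ) 1)).prod (μ.restrict (g j '' E j)) with hνj
  have hνsum : ν = Measure.sum νj := by
    rw [hν, ← Measure.restrict_congr_set hWae, Measure.restrict_iUnion hdisj hgm,
      Measure.prod_sum_right]
  have hsumj : HasSum (fun j => ∫ q, Φ q ∂(νj j)) (∫ q, Φ q ∂ν) := by
    rw [hνsum]
    exact hasSum_integral_measure (by rw [← hνsum]; exact hΦint)
  -- per piece `j`: `∫ Φ dνⱼ = Σₙ R (j, n) ψ`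
  have hpiece : ∀ j, HasSum (fun n => R (Nat.pairEquiv (j, n)) ψ) (∫ q, Φ q ∂(νj j)) := by
    intro j
    have hgd' : ∀ u ∈ E j, HasFDerivWithinAt (g j) (fderiv ℝ (g j) u) (E j) u := fun u hu =>
      (hgd j u hu).1.hasFDerivAt.hasFDerivWithinAt
    have hinj' : ∀ u ∈ E j, Injective (fderiv ℝ (g j) u) := fun u hu => (hgd j u hu).2
    -- Fubini on the piece and the area formula per time
    have hνjle : νj j ≤ ν := by
      rw [hνsum]; exact Measure.le_sum νj j
    have h1 : ∫ q, Φ q ∂(νj j) = ∫ t' in Ioc (0 : ℝ) 1, ∫ u in E j,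
        (((fderiv ℝ (g j) u : 𝔼 →L[ℝ] V) : 𝔼 →ₗ[ℝ] V).normDet) • Φ (t', g j u) := by
      rw [hνj, integral_prod Φ (hΦint.mono_measure hνjle)]
      refine setIntegral_congr_fun measurableSet_Ioc fun t' _ => ?_
      have h := integral_image_eq_integral_normDet_smul (hEm j) hgd' hinj' (hgi j) (fun x => Φ (t', x))
      rw [finrank_euclideanSpace_fin] at h
      exact h
    -- back to the product `(0,1] × E j`
    set Ψ : ℝ × 𝔼 → ℝ := fun q => (((fderiv ℝ (g j) q.2 : 𝔼 →L[ℝ] V) : 𝔼 →ₗ[ℝ] V).normDet) *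
      ((θ (g j q.2) : ℝ) * ψ (H (q.1, g j q.2)) (fun k => fderiv ℝ H (q.1, g j q.2)
        ((Fin.cons ((1 : ℝ), (0 : V)) (fun i => ((0 : ℝ), ξ (g j q.2) i)) : Fin (m + 1) → ℝ × V)
          k))) with hΨdef
    have hΨ_eq : ∀ q : ℝ × 𝔼, Ψ q = Multivector.push (fderiv ℝ H (q.1, g j q.2))
        (Multivector.consTime ((((fderiv ℝ (g j) q.2 : 𝔼 →L[ℝ] V) : 𝔼 →ₗ[ℝ] V).normDet) •
          ((θ (g j q.2) : ℝ) • frameVector (ξ (g j q.2))))) (ψ (H (q.1, g j q.2))) := by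
      intro q
      rw [hΨdef]
      dsimp only
      conv_rhs => rw [map_smul, map_smul, _root_.smul_apply, smul_eq_mul]
      rw [mul_apply_cons_eq_push_consTime (θ := θ) (ξ := ξ) (H := H) ψ]
    have hΨint : IntegrableOn Ψ (Ioc (0 : ℝ) 1 ×ˢ E j) := by
      have hK := integrableOn_normDet_smul_comp (θ := θ) (ξ := ξ) (hEm j) (hgd j) (hgi j)
        (hGint.mono_set (hgW j))
      have hP := integrableOn_push_consTime hH1 (hgL j).continuous (hEm j) hC0 (hCj j) hK
      have hmeas : AEStronglyMeasurable Ψ (volume.restrict (Ioc (0 : ℝ) 1 ×ˢ E j)) := by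
        have h2 : Continuous fun p : Multivector V' (m + 1) × Covector V' (m + 1) => p.1 p.2 :=
          isBoundedBilinearMap_apply.continuous
        refine (h2.comp_aestronglyMeasurable (hP.aestronglyMeasurable.prodMk
          ((ψ.continuous.comp (hH.continuous.comp (continuous_fst.prodMk
            ((hgL j).continuous.comp continuous_snd)))).aestronglyMeasurable))).congr
          (Eventually.of_forall fun q => ?_)
        simp only [comp_apply]
        exact (hΨ_eq q).symm
      refine Integrable.mono' (hP.norm.mul_const c) hmeas (Eventually.of_forall fun q => ?_)
      rw [hΨ_eq q, Real.norm_eq_abs]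
      exact ((Real.norm_eq_abs _) ▸ ContinuousLinearMap.le_opNorm _ _).trans
        (by gcongr; exact hψc _)
    have h2 : ∫ q, Φ q ∂(νj j) = ∫ q in Ioc (0 : ℝ) 1 ×ˢ E j, Ψ q := by
      rw [h1, volume_eq_prod, setIntegral_prod Ψ (by rw [← volume_eq_prod]; exact hΨint)]
      simp only [hΨdef, hΦdef, smul_eq_mul]
    have h3 : ∫ q in Ioc (0 : ℝ) 1 ×ˢ E j, Ψ q = ∫ v in Q j, (prodPieceDensity (g j) θ ξ v : ℝ) *
        ψ (prodMap H (g j) v) (fun k => prodDeriv H (g j) v (prodBasis m k)) :=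
      (setIntegral_prodPiece_eq (H := H) (θ := θ) (hEm j) (hgd j) (hgi j) (hframe j) ψ).symm
    -- parameter side: drop the degenerate part and sum over the sub-pieces
    set Ξ : ℙ → ℝ := fun v => (prodPieceDensity (g j) θ ξ v : ℝ) *
      ψ (prodMap H (g j) v) (fun k => prodDeriv H (g j) v (prodBasis m k)) with hΞdef
    have hFcont : Continuous (prodMap H (g j)) :=
      hH.continuous.comp ((hinner j).continuous.comp (prod_lipschitzWith_ofLp 2 ℝ 𝔼).continuous)
    have hΞint : IntegrableOn Ξ (Q j) := by
      have hmeas : AEStronglyMeasurable Ξ (volume.restrict (Q j)) := by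
        have hA := (hint j).aestronglyMeasurable.prodMk
          ((ψ.continuous.comp hFcont).aestronglyMeasurable (μ := volume.restrict (Q j)))
        have h2 : Continuous fun p : Multivector V' (m + 1) × Covector V' (m + 1) => p.1 p.2 :=
          isBoundedBilinearMap_apply.continuous
        refine (h2.comp_aestronglyMeasurable hA).congr (Eventually.of_forall fun u => ?_)
        simp only [comp_apply, hΞdef, _root_.smul_apply, frameVector_apply, smul_eq_mul]
      refine Integrable.mono' ((hint j).norm.mul_const c) hmeas (Eventually.of_forall fun v => ?_)
      have : Ξ v = ((prodPieceDensity (g j) θ ξ v : ℝ) •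
          frameVector (fun k => prodDeriv H (g j) v (prodBasis m k))) (ψ (prodMap H (g j) v)) := by
        simp only [hΞdef, _root_.smul_apply, frameVector_apply, smul_eq_mul]
      rw [this]
      exact (ContinuousLinearMap.le_opNorm _ _).trans
        (mul_le_mul_of_nonneg_left (hψc _) (norm_nonneg _))
    -- the degenerate part does not contribute
    have h4 : ∫ v in Q j, Ξ v = ∫ v in Q j ∩ ⋃ n, t j n, Ξ v := by
      refine setIntegral_eq_of_subset_of_forall_sdiff_eq_zero (hQm j) inter_subset_left ?_
      rintro v ⟨hvQ, hv⟩
      have hnot : ¬ Injective (prodDeriv H (g j) v) := by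
        intro hinjv
        refine hv ⟨hvQ, ?_⟩
        refine hSt j ⟨(hFd j v hvQ).1, ?_⟩
        rw [(hFd j v hvQ).2]
        exact hinjv
      change (prodPieceDensity (g j) θ ξ v : ℝ) *
        ψ (prodMap H (g j) v) (fun k => prodDeriv H (g j) v (prodBasis m k)) = 0
      rw [apply_comp_eq_zero_of_not_injective hnot (prodBasis m), mul_zero]
    -- `Σₙ`
    have h5 : HasSum (fun n => ∫ v in Q j ∩ t j n, Ξ v) (∫ v in Q j ∩ ⋃ n, t j n, Ξ v) := by
      rw [inter_iUnion]
      exact hasSum_integral_iUnion (fun n => (hQm j).inter (htm j n))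
        (fun n n' h => (htdisj j h).mono inter_subset_right inter_subset_right)
        (hΞint.mono_set (iUnion_subset fun n => inter_subset_left))
    have h6 : ∀ n, ∫ v in Q j ∩ t j n, Ξ v = R (Nat.pairEquiv (j, n)) ψ := by
      intro n
      have := (hR (Nat.pairEquiv (j, n))).2.1 ψ
      simp only [hRdef, hΞdef, E', jj, nn, Nat.pairEquiv_apply, Function.uncurry_apply_pair,
        Nat.unpair_pair] at this ⊢
      exact this.symm
    rw [h2, h3]
    change HasSum (fun n => R (Nat.pairEquiv (j, n)) ψ) (∫ v in Q j, Ξ v)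
    rw [h4]
    simpa only [h6] using h5
  -- assemble the double series
  have hRψ' : Summable fun q : ℕ × ℕ => R (Nat.pairEquiv q) ψ :=
    (Nat.pairEquiv.summable_iff (f := fun k => R k ψ)).2 hRψ
  rw [← Nat.pairEquiv.tsum_eq (fun k => R k ψ), hRψ'.tsum_prod' (fun j => (hpiece j).summable),
    ← hsumj.tsum_eq]
  exact tsum_congr fun j => ((hpiece j).tsum_eq).symm

end Main

end Literature.Geometry.GeometricMeasureTheory
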